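import Summits.CriticalPhenomena.CardyFormulaZ2.Theses.CardyQContinuation
import Summits.CriticalPhenomena.CardyFormulaZ2.Theorems.CardyQContinuationIsingJetsConformalStubFrontierNearMeshBoundary
import Literature.Probability.Percolation.BoxCrossingLowerBound
import Literature.Probability.RandomPlanarGeometry.PlanarDomainsTopology

/-!
# Crux `IsingJetsConformal`, stub `stub_isingCrossingConformal_arc_near_discreteArc`:
# every point of a boundary arc is near the discrete arc of `Ω_δ`
# (route `CardyQContinuation`, item stmt-CriticalPhenomena-5560)

The transplant of Chelkak–Smirnov's crossing theorem to the tree's discretisation of a conformal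
rectangle `R` (`meshDomain Ω δ` with vertex boundary `meshBoundary Ω δ` and discrete arcs
`discreteArc Ω δ A` — the discrete boundary vertices at least as close to `A` as to `∂Ω ∖ A`,
`DomainDiscretisation.lean`) needs Hausdorff convergence of each rescaled discrete arc
`δ · discreteArc (arc i)` to the continuum arc `arc i`. One half is
`Literature.Probability.Percolation.infDist_le_of_mem_discreteArc` (a discrete-arc vertex is
within `δ` of its arc). This file proves the other half, uniformly in the point and in the arc:
for every `ε > 0`, for all small `δ > 0`, every point of `arc i` has a vertex of
`discreteArc R.carrier δ (arc i)` whose mesh point is within `ε` of it.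

Proof. Pointwise at an *interior* point `a' = boundary t`, `mark i < t < nextMark i`, of the arc
(`eventually_exists_discreteArc_near_boundary`): some ball `B(a', r)` meets `∂Ω` only in `arc i`
while the other arcs stay at distance `≥ r` (`MarkedDomain.exists_pos_forall_mem_arc_of_dist_lt`);
by the landed stub `FrontierNearMeshBoundary.eventually_exists_meshBoundary_near`, for small `δ`
a discrete boundary vertex `x` has `dist (δ x) a' ≤ min η (r/4)`, and such a vertex, having a
lattice edge that leaves `Ω` within `r` of `a'`, lies on the discrete arc of `arc i`
(`Percolation.mem_discreteArc_of_exit`). Uniformity: the `ε/2`-balls about interior points cover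
the compact arc (endpoints are limits of interior points), so finitely many suffice, and finitely
many `∀ᶠ δ` conditions intersect (`Set.Finite.eventually_all`, `Filter.eventually_all` over
`Fin 4`).

References: S. Smirnov, C. R. Acad. Sci. Paris 333 (2001), §2 (the discretisation, "the discrete
arc is the set of boundary vertices closest to the arc"); D. Chelkak, S. Smirnov, Invent. Math.
189 (2012), §1.2, Thm. 6.1.
-/

namespace Summit.CriticalPhenomena.CardyFormulaZ2.Theorems.CardyQContinuation

open Set Metric Filter
open scoped Topology
open Literature.Probability.LatticeModels Literature.Probability.Percolation
open Literature.Probability.RandomPlanarGeometry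

noncomputable section

namespace ArcNearDiscreteArc

/-- For a conformal rectangle, the boundary off any one arc is nonempty: it contains the
midpoint of the opposite arc `arc (i + 2)`. [folklore] -/
theorem frontier_diff_arc_nonempty_fin_four (R : ConformalRectangle) (i : Fin 4) :
    (frontier R.carrier \ R.arc i).Nonempty := by
  have hi : i ≠ i + 2 := by revert i; decide
  refine ⟨R.boundary ((R.mark (i + 2) + R.nextMark (i + 2)) / 2), R.boundary_mem_frontier _, ?_⟩
  exact R.boundary_not_mem_arc hi (R.midpoint_mem_Ioo (i + 2))

/-- **Pointwise form at an interior point of an arc.** For a conformal rectangle `R`, an interior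
parameter `t ∈ (mark i, nextMark i)` of the arc `arc i` and `η > 0`, for all small `δ > 0` some
vertex of the discrete arc `discreteArc R.carrier δ (arc i)` has its mesh point within `η` of
`boundary t`: a discrete boundary vertex close to `boundary t` (landed stub
`eventually_exists_meshBoundary_near`) has an exit edge meeting `∂Ω` near `boundary t`, hence on
`arc i`, while the other arcs are far (`mem_discreteArc_of_exit`). [folklore] -/
theorem eventually_exists_discreteArc_near_boundary (R : ConformalRectangle) (i : Fin 4) {t : ℝ}
    (ht : t ∈ Ioo (R.mark i) (R.nextMark i)) {η : ℝ} (hη : 0 < η) :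
    ∀ᶠ δ in 𝓝[>] (0 : ℝ), ∃ x ∈ discreteArc R.carrier δ (R.arc i),
      dist (meshPoint δ x) (R.boundary t) ≤ η := by
  obtain ⟨r, hr, hri, hrj⟩ := R.exists_pos_forall_mem_arc_of_dist_lt i ht
  have hne := frontier_diff_arc_nonempty_fin_four R i
  have h1 := FrontierNearMeshBoundary.eventually_exists_meshBoundary_near R.toJordanDomain
    (R.boundary_mem_frontier t) (lt_min hη (by positivity : (0 : ℝ) < r / 4))
  have h2 : ∀ᶠ δ in 𝓝[>] (0 : ℝ), δ ∈ Ioo 0 (r / 4) := Ioo_mem_nhdsGT (by positivity)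
  filter_upwards [h1, h2] with δ hδ1 hδ2
  obtain ⟨x, hxb, hxd⟩ := hδ1
  obtain ⟨hδ, hδr⟩ := hδ2
  refine ⟨x, ?_, hxd.trans (min_le_left _ _)⟩
  obtain ⟨y, hxy, w, hw, hwf⟩ := exists_mem_frontier_of_mem_meshBoundary R.isOpen hxb
  have hseg : ¬ segment ℝ (meshPoint δ x) (meshPoint δ y) ⊆ R.carrier := fun h =>
    Set.disjoint_left.1 R.disjoint_carrier_frontier (h hw) hwf
  have hxr : dist (meshPoint δ x) (R.boundary t) ≤ r / 4 := hxd.trans (min_le_right _ _)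
  exact mem_discreteArc_of_exit R hri hrj hne hδ hxb hxy hseg (by linarith)

/-- The `ε`-balls about the interior points `boundary t`, `mark i < t < nextMark i`, cover the
whole closed arc `arc i` (its endpoints are limits of interior points along the continuous
boundary loop). [folklore] -/
theorem arc_subset_iUnion_ball_boundary {n : ℕ} (D : MarkedDomain n) (i : Fin n) {ε : ℝ}
    (hε : 0 < ε) :
    D.arc i ⊆ ⋃ t ∈ Ioo (D.mark i) (D.nextMark i), ball (D.boundary t) ε := by
  rintro _ ⟨s, hs, rfl⟩
  have hsc : s ∈ closure (Ioo (D.mark i) (D.nextMark i)) := by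
    rw [closure_Ioo (D.mark_lt_nextMark i).ne]
    exact hs
  obtain ⟨γ, hγ, hγε⟩ := Metric.continuousAt_iff.1 (D.continuous_boundary.continuousAt (x := s)) ε hε
  obtain ⟨t, ht, hst⟩ := Metric.mem_closure_iff.1 hsc γ hγ
  refine mem_iUnion₂.2 ⟨t, ht, ?_⟩
  rw [mem_ball, dist_comm]
  rw [dist_comm] at hst
  exact hγε hst

end ArcNearDiscreteArc

open ArcNearDiscreteArc

/-- **Stub `stub_isingCrossingConformal_arc_near_discreteArc`** of the skeleton of the crux
`IsingJetsConformal` (stmt-CriticalPhenomena-5560): the converse half of the Hausdorff convergence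
`δ · discreteArc (arc i) → arc i` of the discrete arcs of the tree's discretisation of a conformal
rectangle — for every `ε > 0`, for all small `δ > 0`, every point `p` of every boundary arc
`arc i` has a vertex of `discreteArc R.carrier δ (arc i)` whose mesh point is within `ε` of `p`
(uniformly in `p` and `i`: compactness of the arcs, covered by `ε/2`-balls about interior points,
and the pointwise form `eventually_exists_discreteArc_near_boundary`). [folklore] -/
theorem stub_isingCrossingConformal_arc_near_discreteArc : (∀ (R : Literature.Probability.RandomPlanarGeometry.ConformalRectangle) (ε : ℝ), 0 < ε → ∀ᶠ δ in nhdsWithin (0:ℝ) (Set.Ioi 0), ∀ (i : Fin 4), ∀ p ∈ R.arc i, ∃ x ∈ Literature.Probability.LatticeModels.discreteArc R.carrier δ (R.arc i), dist (Literature.Probability.LatticeModels.meshPoint δ x) p ≤ ε) := by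
  intro R ε hε
  refine eventually_all.2 fun i => ?_
  obtain ⟨b, hbsub, hbfin, hbcover⟩ := (R.isCompact_arc i).elim_finite_subcover_image
    (fun t _ => isOpen_ball) (arc_subset_iUnion_ball_boundary R i (half_pos hε))
  have key : ∀ᶠ δ in 𝓝[>] (0 : ℝ), ∀ t ∈ b,
      ∃ x ∈ discreteArc R.carrier δ (R.arc i), dist (meshPoint δ x) (R.boundary t) ≤ ε / 2 :=
    hbfin.eventually_all.2 fun t ht =>
      eventually_exists_discreteArc_near_boundary R i (hbsub ht) (half_pos hε)
  filter_upwards [key] with δ hδ p hp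
  obtain ⟨t, htb, hpt⟩ : ∃ t ∈ b, p ∈ ball (R.boundary t) (ε / 2) := by
    simpa only [mem_iUnion, exists_prop] using hbcover hp
  obtain ⟨x, hx, hxd⟩ := hδ t htb
  refine ⟨x, hx, ?_⟩
  rw [mem_ball] at hpt
  linarith [dist_triangle (meshPoint δ x) (R.boundary t) p, dist_comm p (R.boundary t)]

end

end Summit.CriticalPhenomena.CardyFormulaZ2.Theorems.CardyQContinuation
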